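import Summits.ValiantsHypothesis.ValiantsHypothesis.Theorems.BarrierLeverAnchoredDoorHitsLowerPairsUQFaceResidualSplit

/-!
# Support item `AnchoredDoorHitsLowerPairs` (stmt-ValiantsHypothesis-22510), line `anchored-peeling`:
# CONJECTURE M (generic door monomials) — typed, with the kernel reduction to the `ψ = 0` member of 𝔄₁, and the second residual split

Helper file (`--supports stmt-ValiantsHypothesis-22510`; cell valiant-natproofs, rung V4, 𝒟-side door (c); registered line
`Cruxes/AnchoredDoorHitsLowerPairs/Lines/anchored_peeling.lean` v14/v15; prover seat val-np-p1 gen 20; memo HOME/val-np-p1/g20/UQFACE-KERNEL-valnp1-g20.md §6).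
Closes NO item.

THE `ψ = 0` MEMBER. Evaluate the profile-1 symbolic witness at `mPoint θ φ`: every vertex anchor `(b | γ)` keeps its weight `θ b γ` and its `x`-tails `φ b γ ·`,
all `y`-tails are `0`. The member is `∏_γ cpart_γ` (`cpart` of `…TotalMultiPeel`, one factor per column vertex) and its layout entries are
(`coeff_prod_cpart`) `[x^U y^W] ∏_γ cpart_γ = [x^U] ∏_{γ ∈ W} D_γ`, where `D_γ = Σ_b θ_{bγ} x_b ∏_{b'≠b}(1 + φ_{bγb'} x_{b'})` (`doorElem`) is an independent
generic DOOR ELEMENT of the zeon algebra `Z_X` for each column vertex `γ`: the column `W` of the layout is the door MONOMIAL `D^W = ∏_{γ∈W} D_γ` read on the row faces.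

CONJECTURE M (`Stmt.stub_conjM`, typed, OFFERED): for every injective pair of lower families `(R, C)` of equal size in which the column PROFILE is dominated
by the row profile (`#{W ∈ C : |W| ≥ d} ≤ #{U ∈ R : |U| ≥ d}` for all `d` — necessary, since `D^W ∈ 𝔪^{|W|}`), there are complex `θ, φ` with
`det [ [x^U] D^W ]_{U ∈ R, W ∈ C} ≠ 0`. For `R = 2^X` this says «the door monomials `{D^W}_{W ∈ C}` form a basis of `Z_X`»; it is WEAKER than Conjecture L
(which is its specialisation `D_γ = x_{πγ}` for all but one `γ`) and numerically alive (memo §6: 216/216 + 158/158, `n ≤ 5`; lowerness of `C` is load-bearing: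
a non-lower profile-dominated family fails at `n = 4`).

* `mPoint`, `map_mPoint_symbolicWitness` (`= ∏_γ cpart_γ`), `cfacCore_eq_sum`, `coeff_cfacCore_mul`, `coeff_prod_cpart`.
* `ProfileDominated u w`, `Stmt.stub_conjM`, **`symbolicDet_one_ne_zero_of_conjM : Stmt.stub_conjM → (profile-dominated lower pair) → symbolicDet 1 ≠ 0`**.
* `Stmt.stub_uqFaceResidualRestM` (the registered residual minus the pairs with one-sided profile domination) and the LOSSLESS MERGER
  `stub_uqFaceResidual_of_conjM_rest : Stmt.stub_conjM → Stmt.stub_uqFaceResidualRestM → Stmt.stub_uqFaceResidual`, hence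
  `anchoredDoorHitsLowerPairs_of_conjM_rest` (route decl BY NAME).

WHAT THIS IS NOT: Conjecture M is OPEN; nothing on crux stmt-ValiantsHypothesis-14610 or on `VP` versus `VNP`.
-/

set_option linter.dupNamespace false

namespace Summit.ValiantsHypothesis.ValiantsHypothesis.Theorems.BarrierLever.AnchoredPeeling

open Finset MvPolynomial
open Summit.ValiantsHypothesis.ValiantsHypothesis.Theorems.BarrierLever.BrickCalculus (pexpo pexpo_def pexpo_le_iff pexpo_sub
  pexpo_apply_natAdd pexpo_apply_castAdd)

noncomputable section

variable {h : ℕ}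

/-! ## 1. Door elements and the `ψ = 0` point -/

/-- The door element of the column vertex `γ`: `D_γ = Σ_b θ_{bγ} x_b ∏_{b'≠b} (1 + φ_{bγb'} x_{b'})` (an `x`-only element of the zeon algebra). -/
def doorElem (θ : Fin h → Fin h → ℂ) (φ : Fin h → Fin h → Fin h → ℂ) (γ : Fin h) : MvPolynomial (Fin (h + h)) ℂ :=
  ∑ b, cfacCore (fun b => θ b γ) (fun b b' => φ b γ b') b

/-- The `ψ = 0` point of 𝔄₁: the vertex anchor `(b | γ)` has weight `θ b γ` and `x`-tails `φ b γ ·`; no `y`-tails. (Values on other anchors are irrelevant at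
profile `1`.) -/
def mPoint (θ : Fin h → Fin h → ℂ) (φ : Fin h → Fin h → Fin h → ℂ) : Param h → ℂ
  | Sum.inl α => ∑ b ∈ α.1, ∑ γ ∈ α.2, θ b γ
  | Sum.inr (Sum.inl (α, b')) => ∑ b ∈ α.1, ∑ γ ∈ α.2, φ b γ b'
  | Sum.inr (Sum.inr _) => 0

section Member

variable (θ : Fin h → Fin h → ℂ) (φ : Fin h → Fin h → Fin h → ℂ)

/-- The factor of the vertex anchor `({b}, {γ})` at the `ψ = 0` point is `cfac (θ · γ) (φ · γ ·) γ b`. -/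
theorem map_mPoint_symbFactor (b γ : Fin h) :
    MvPolynomial.map (eval (mPoint θ φ)) (symbFactor h ({b}, {γ})) = cfac (fun b => θ b γ) (fun b b' => φ b γ b') γ b := by
  classical
  rw [symbFactor_eq]
  simp only [map_add, map_one, map_mul, map_prod, map_monomial, map_C, map_X, eval_X, _root_.map_one, mPoint, Finset.sum_singleton,
    C_0, zero_mul, add_zero, Finset.prod_const_one, mul_one]
  rw [cfac, cfacCore]
  have hmm : (monomial (pexpo (∅ : Finset (Fin h)) {γ}) (1 : ℂ) * monomial (pexpo ({b} : Finset (Fin h)) ∅) 1 :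
      MvPolynomial (Fin (h + h)) ℂ) = monomial (pexpo {b} {γ}) 1 := by
    rw [monomial_mul, one_mul, ← pexpo_union (Finset.disjoint_empty_left _) (Finset.disjoint_empty_right _), Finset.empty_union,
      Finset.union_empty]
  rw [← mul_assoc (monomial (pexpo (∅ : Finset (Fin h)) {γ}) (1 : ℂ)), hmm]

/-- **The `ψ = 0` member of 𝔄₁** is `∏_γ cpart_γ`. -/
theorem map_mPoint_symbolicWitness :
    MvPolynomial.map (eval (mPoint θ φ)) (symbolicWitness 1 h) = ∏ γ : Fin h, cpart (fun b => θ b γ) (fun b b' => φ b γ b') γ := by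
  classical
  let vx : Fin h × Fin h → Finset (Fin h) × Finset (Fin h) := fun q => ({q.1}, {q.2})
  have hvx : Function.Injective vx := fun q q' hqq =>
    Prod.ext (Finset.singleton_injective (congrArg Prod.fst hqq)) (Finset.singleton_injective (congrArg Prod.snd hqq))
  have hanch : anchors 1 h = (Finset.univ : Finset (Fin h × Fin h)).image vx := by
    ext α
    simp only [anchors, Finset.mem_filter, Finset.mem_univ, true_and, Finset.mem_image, vx]
    constructor
    · rintro ⟨h1, h2, h3, h4⟩
      obtain ⟨a, ha⟩ := Finset.card_eq_one.mp (le_antisymm h2 h1)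
      obtain ⟨d, hd⟩ := Finset.card_eq_one.mp (le_antisymm h4 h3)
      exact ⟨(a, d), Prod.ext ha.symm hd.symm⟩
    · rintro ⟨q, rfl⟩
      simp
  rw [symbolicWitness_eq_prod, map_prod, hanch, Finset.prod_image (fun q _ q' _ hqq => hvx hqq)]
  simp only [vx]
  rw [← Finset.univ_product_univ, Finset.prod_product_right]
  refine Finset.prod_congr rfl (fun γ _ => ?_)
  rw [cpart]
  exact Finset.prod_congr rfl (fun b _ => map_mPoint_symbFactor θ φ b γ)

end Member

/-! ## 2. Reading products: `[x^U y^W] ∏_γ cpart_γ = [x^U] ∏_{γ ∈ W} D_γ` -/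

/-- `cfacCore b` as a sum of monomials: `Σ_{Z ⊆ X∖b} (θ_b ∏_{Z} φ_{b·}) · x^{b ∪ Z}`. -/
theorem cfacCore_eq_sum (θ : Fin h → ℂ) (φ : Fin h → Fin h → ℂ) (b : Fin h) :
    cfacCore θ φ b = ∑ Z ∈ (univ \ {b} : Finset (Fin h)).powerset, monomial (pexpo (insert b Z) ∅) (θ b * ∏ d ∈ Z, φ b d) := by
  classical
  rw [cfacCore, ProductRule.prod_one_add_C_mul_X_fun, Finset.mul_sum, Finset.mul_sum]
  refine Finset.sum_congr rfl (fun Z hZ => ?_)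
  have hbZ : b ∉ Z := fun hb => by simpa using Finset.mem_powerset.mp hZ hb
  have hpe : (∑ d ∈ Z, Finsupp.single (Fin.castAdd h d) 1 : Fin (h + h) →₀ ℕ) = pexpo Z ∅ := by
    rw [pexpo_def, Finset.sum_empty, add_zero]
  rw [hpe, C_mul_monomial, monomial_mul, one_mul, ← pexpo_union (Finset.disjoint_singleton_left.mpr hbZ) (Finset.disjoint_empty_left _),
    Finset.empty_union, ← Finset.insert_eq]

/-- **Convolution with a core**: `[x^U y^W'] (cfacCore b · G) = Σ_{Z ⊆ X∖b, b∪Z ⊆ U} θ_b φ_b^Z · [x^{U∖(b∪Z)} y^{W'}] G`. -/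
theorem coeff_cfacCore_mul (θ : Fin h → ℂ) (φ : Fin h → Fin h → ℂ) (b : Fin h) (G : MvPolynomial (Fin (h + h)) ℂ) (U W' : Finset (Fin h)) :
    coeff (pexpo U W') (cfacCore θ φ b * G) =
      ∑ Z ∈ (univ \ {b} : Finset (Fin h)).powerset,
        (if insert b Z ⊆ U then (θ b * ∏ d ∈ Z, φ b d) * coeff (pexpo (U \ insert b Z) W') G else 0) := by
  classical
  rw [cfacCore_eq_sum, Finset.sum_mul, coeff_sum]
  refine Finset.sum_congr rfl (fun Z _ => ?_)
  rw [coeff_monomial_mul']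
  by_cases hsub : insert b Z ⊆ U
  · rw [if_pos ((pexpo_le_iff _ _ _ _).mpr ⟨hsub, Finset.empty_subset _⟩), if_pos hsub, pexpo_sub _ _ _ _ hsub (Finset.empty_subset _),
      Finset.sdiff_empty]
  · rw [if_neg (fun hle => hsub ((pexpo_le_iff _ _ _ _).mp hle).1), if_neg hsub]

section Products

variable (θ : Fin h → Fin h → ℂ) (φ : Fin h → Fin h → Fin h → ℂ)

/-- Shorthand: the `c₀ = γ` part of the `ψ = 0` member. -/
private abbrev cp (γ : Fin h) : MvPolynomial (Fin (h + h)) ℂ := cpart (fun b => θ b γ) (fun b b' => φ b γ b') γ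

/-- A product of `cpart`s over vertices other than `γ₀` has no `y_{γ₀}`: its readings on faces containing `γ₀` vanish. -/
theorem coeff_prod_cpart_eq_zero (Γ' : Finset (Fin h)) {γ₀ : Fin h} (hγ₀ : γ₀ ∉ Γ') (U W : Finset (Fin h)) (hW : γ₀ ∈ W) :
    coeff (pexpo U W) (∏ γ ∈ Γ', cpart (fun b => θ b γ) (fun b b' => φ b γ b') γ) = 0 := by
  classical
  have hkill : ThinStep.killVars {Fin.natAdd h γ₀} (∏ γ ∈ Γ', cpart (fun b => θ b γ) (fun b b' => φ b γ b') γ) =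
      ∏ γ ∈ Γ', cpart (fun b => θ b γ) (fun b b' => φ b γ b') γ := by
    rw [map_prod]
    exact Finset.prod_congr rfl (fun γ hγ => killVars_cpart _ _ γ γ₀ (fun heq => hγ₀ (heq ▸ hγ)))
  rw [← hkill]
  refine ThinStep.coeff_killVars_of_not_disjoint _ _ (fun hdis => ?_)
  have hmem : Fin.natAdd h γ₀ ∈ (pexpo U W).support := by
    rw [Finsupp.mem_support_iff, pexpo_apply_natAdd, if_pos hW]; exact one_ne_zero
  exact (Finset.disjoint_right.mp hdis (Finset.mem_singleton_self _)) hmem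

/-- **Reading products of `cpart`s**: for `W ⊆ Γ'`, `[x^U y^W] ∏_{γ ∈ Γ'} cpart_γ = [x^U] ∏_{γ ∈ W} D_γ`. -/
theorem coeff_prod_cpart (Γ' : Finset (Fin h)) :
    ∀ U W : Finset (Fin h), W ⊆ Γ' →
      coeff (pexpo U W) (∏ γ ∈ Γ', cpart (fun b => θ b γ) (fun b b' => φ b γ b') γ) = coeff (pexpo U ∅) (∏ γ ∈ W, doorElem θ φ γ) := by
  classical
  induction Γ' using Finset.induction_on with
  | empty =>
    intro U W hW
    rw [Finset.subset_empty.mp hW, Finset.prod_empty, Finset.prod_empty]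
  | insert γ₀ Γ' hγ₀ ih =>
    intro U W hW
    rw [Finset.prod_insert hγ₀]
    -- expand cpart_{γ₀} = 1 + y_{γ₀} D_{γ₀} + y_{γ₀}² R
    obtain ⟨Rm, hRm⟩ := prod_one_add_monomial_mul (Finset.univ : Finset (Fin h)) (pexpo (∅ : Finset (Fin h)) {γ₀})
      (cfacCore (fun b => θ b γ₀) (fun b b' => φ b γ₀ b'))
    have hcp : cpart (fun b => θ b γ₀) (fun b b' => φ b γ₀ b') γ₀ =
        1 + ∑ b, monomial (pexpo (∅ : Finset (Fin h)) {γ₀}) 1 * cfacCore (fun b => θ b γ₀) (fun b b' => φ b γ₀ b') b +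
          monomial (pexpo (∅ : Finset (Fin h)) {γ₀} + pexpo (∅ : Finset (Fin h)) {γ₀}) 1 * Rm := by
      rw [cpart]; exact hRm
    set G := ∏ γ ∈ Γ', cpart (fun b => θ b γ) (fun b b' => φ b γ b') γ with hG
    rw [hcp, add_mul, add_mul, one_mul, coeff_add, coeff_add, Finset.sum_mul, coeff_sum]
    -- the y_{γ₀}² part never reads square-free
    have h2 : coeff (pexpo U W) (monomial (pexpo (∅ : Finset (Fin h)) {γ₀} + pexpo (∅ : Finset (Fin h)) {γ₀}) (1 : ℂ) * Rm * G) = 0 := by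
      rw [mul_assoc]; exact coeff_pexpo_monomial_two_mul ⟨γ₀, Finset.mem_singleton_self γ₀⟩ _ U W
    rw [h2, add_zero]
    by_cases hγW : γ₀ ∈ W
    · -- the `1·G` part vanishes (no y_{γ₀} in G); the linear part reads D_{γ₀} against G on W ∖ γ₀
      rw [coeff_prod_cpart_eq_zero θ φ Γ' hγ₀ U W hγW, zero_add]
      have hW' : W.erase γ₀ ⊆ Γ' := fun x hx => by
        have hx' := Finset.mem_erase.mp hx
        rcases Finset.mem_insert.mp (hW hx'.2) with h' | h'
        · exact absurd h' hx'.1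
        · exact h'
      have hle : pexpo (∅ : Finset (Fin h)) {γ₀} ≤ pexpo U W := (pexpo_le_iff _ _ _ _).mpr ⟨Finset.empty_subset _, Finset.singleton_subset_iff.mpr hγW⟩
      have hsub : pexpo U W - pexpo (∅ : Finset (Fin h)) {γ₀} = pexpo U (W.erase γ₀) := by
        rw [pexpo_sub _ _ _ _ (Finset.empty_subset _) (Finset.singleton_subset_iff.mpr hγW), Finset.sdiff_empty, Finset.sdiff_singleton_eq_erase]
      have hterm : ∀ b, coeff (pexpo U W) (monomial (pexpo (∅ : Finset (Fin h)) {γ₀}) (1 : ℂ) * cfacCore (fun b => θ b γ₀) (fun b b' => φ b γ₀ b') b * G) =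
          ∑ Z ∈ (univ \ {b} : Finset (Fin h)).powerset,
            (if insert b Z ⊆ U then (θ b γ₀ * ∏ d ∈ Z, φ b γ₀ d) * coeff (pexpo (U \ insert b Z) ∅) (∏ γ ∈ W.erase γ₀, doorElem θ φ γ) else 0) := by
        intro b
        rw [mul_assoc, coeff_monomial_mul', if_pos hle, one_mul, hsub, coeff_cfacCore_mul]
        refine Finset.sum_congr rfl (fun Z _ => ?_)
        split_ifs
        · rw [ih _ _ hW']
        · rfl
      rw [Finset.sum_congr rfl (fun b _ => hterm b), ← Finset.mul_prod_erase W (doorElem θ φ) hγW, doorElem, Finset.sum_mul, coeff_sum]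
      refine Finset.sum_congr rfl (fun b _ => ?_)
      rw [coeff_cfacCore_mul]
    · -- γ₀ ∉ W: only the `1·G` part reads
      have hW' : W ⊆ Γ' := fun x hx => by
        rcases Finset.mem_insert.mp (hW hx) with h' | h'
        · exact absurd (h' ▸ hx) hγW
        · exact h'
      have hno : ¬ pexpo (∅ : Finset (Fin h)) {γ₀} ≤ pexpo U W := fun hle =>
        hγW (((pexpo_le_iff _ _ _ _).mp hle).2 (Finset.mem_singleton_self γ₀))
      rw [ih U W hW', Finset.sum_eq_zero (fun b _ => by rw [mul_assoc, coeff_monomial_mul', if_neg hno]), add_zero]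

end Products

/-! ## 3. Conjecture M (typed) and the reduction -/

/-- The column profile is dominated by the row profile: for every `d`, at most as many columns of size `≥ d` as rows of size `≥ d`. -/
def ProfileDominated {r : ℕ} (u w : Fin r → Finset (Fin h)) : Prop :=
  ∀ d : ℕ, (Finset.univ.filter (fun j => d ≤ (w j).card)).card ≤ (Finset.univ.filter (fun i => d ≤ (u i).card)).card

/-- **CONJECTURE M (generic door monomials; OFFERED stub text).** For every injective pair of simplicial complexes `(R, C)` of equal size whose column profile is
dominated by the row profile there are complex weights `θ` and `x`-tails `φ` such that the door monomials `D^W = ∏_{γ∈W} D_γ`, `W ∈ C`, read on the row faces,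
form a nonsingular matrix: `det [ [x^U] D^W ]_{U ∈ R, W ∈ C} ≠ 0`. Numerics: memo UQFACE-KERNEL-valnp1-g20 §6. UNPROVED. -/
def Stmt.stub_conjM : Prop :=
  ∀ (h r : ℕ) (u w : Fin r → Finset (Fin h)), Function.Injective u → Function.Injective w →
    IsLowerSet (Set.range u) → IsLowerSet (Set.range w) → ProfileDominated u w →
    ∃ (θ : Fin h → Fin h → ℂ) (φ : Fin h → Fin h → Fin h → ℂ),
      (Matrix.of fun i j : Fin r => coeff (pexpo (u i) ∅) (∏ γ ∈ w j, doorElem θ φ γ)).det ≠ 0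

/-- **CONJECTURE M ⟹ every profile-dominated lower pair is hit at profile 1** (the `ψ = 0` member). -/
theorem symbolicDet_one_ne_zero_of_conjM (hM : Stmt.stub_conjM) {r : ℕ} (u w : Fin r → Finset (Fin h)) (hu : Function.Injective u)
    (hw : Function.Injective w) (hlu : IsLowerSet (Set.range u)) (hlw : IsLowerSet (Set.range w)) (hdom : ProfileDominated u w) :
    symbolicDet 1 h r u w ≠ 0 := by
  classical
  obtain ⟨θ, φ, hdet⟩ := hM h r u w hu hw hlu hlw hdom
  intro h0
  have hmap := congrArg (eval (mPoint θ φ)) h0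
  rw [map_zero, symbolicDet, RingHom.map_det] at hmap
  apply hdet
  rw [← hmap]
  congr 1
  refine Matrix.ext (fun i j => ?_)
  rw [RingHom.mapMatrix_apply, Matrix.map_apply, Matrix.of_apply, Matrix.of_apply, ← pexpo_def, ← coeff_map, map_mPoint_symbolicWitness,
    coeff_prod_cpart θ φ Finset.univ (u i) (w j) (Finset.subset_univ _)]

/-! ## 4. The second residual split: Conjecture M takes the profile-dominated pairs -/

/-- **STUB TEXT (offered): THE FACE-UQ RESIDUAL MINUS THE PROFILE-DOMINATED PAIRS.** At some fixed profile `s ≥ 1` and all `h ≥ h₀`: every injective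
simplicial-complex pair with `r ≥ 2` rows, NO face-UQ data on either side, and whose two profiles CROSS (neither dominates the other), has nonzero symbolic minor. -/
def Stmt.stub_uqFaceResidualRestM : Prop :=
  ∃ s h₀ : ℕ, 1 ≤ s ∧ ∀ h : ℕ, h₀ ≤ h → ∀ (r : ℕ) (u w : Fin r → Finset (Fin h)),
    Function.Injective u → Function.Injective w → IsLowerSet (Set.range u) → IsLowerSet (Set.range w) → 2 ≤ r →
    (∀ (a : Fin h) (W₀ : Finset (Fin h)) (𝒜 : Finset (Finset (Fin h))) (ρ : Finset (Fin h) → Finset (Fin h)), ¬ UQFData s u w a W₀ 𝒜 ρ) →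
    (∀ (c : Fin h) (Z : Finset (Fin h)) (𝒜 : Finset (Finset (Fin h))) (ρ : Finset (Fin h) → Finset (Fin h)), ¬ UQFData s w u c Z 𝒜 ρ) →
    ¬ ProfileDominated u w → ¬ ProfileDominated w u →
    symbolicDet s h r u w ≠ 0

/-- **The lossless merger (kernel-checked): Conjecture M ∧ crossing-profile rest ⟹ the registered residual `Stmt.stub_uqFaceResidual`.** -/
theorem stub_uqFaceResidual_of_conjM_rest (hM : Stmt.stub_conjM) (hR : Stmt.stub_uqFaceResidualRestM) : Stmt.stub_uqFaceResidual := by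
  obtain ⟨s, h₀, hs, hR⟩ := hR
  refine ⟨s, h₀, hs, fun h hh r u w hu hw hlu hlw hr hx hy => ?_⟩
  by_cases hdx : ProfileDominated u w
  · exact symbolicDet_ne_zero_mono hs (symbolicDet_one_ne_zero_of_conjM hM u w hu hw hlu hlw hdx)
  · by_cases hdy : ProfileDominated w u
    · exact (symbolicDet_ne_zero_comm s h r u w).mpr (symbolicDet_ne_zero_mono hs (symbolicDet_one_ne_zero_of_conjM hM w u hw hu hlw hlu hdy))
    · exact hR h hh r u w hu hw hlu hlw hr hx hy hdx hdy

/-- **Composition BY NAME: Conjecture M ∧ crossing-profile rest ⟹ the support item `AnchoredDoorHitsLowerPairs`.** -/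
theorem anchoredDoorHitsLowerPairs_of_conjM_rest (hM : Stmt.stub_conjM) (hR : Stmt.stub_uqFaceResidualRestM) :
    Summit.ValiantsHypothesis.ValiantsHypothesis.Theses.BarrierLever.AnchoredDoorHitsLowerPairs := by
  obtain ⟨s, h₀, K⟩ := anchoredHit_of_uqFace stub_uqFaceStep (stub_uqFaceResidual_of_conjM_rest hM hR)
  exact ⟨s, h₀, fun h hh r u w hu hw hlu hlw => K h hh r u w hu hw hlu hlw⟩

end

end Summit.ValiantsHypothesis.ValiantsHypothesis.Theorems.BarrierLever.AnchoredPeeling
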